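import Summits.BirchSwinnertonDyer.Rank1Residual.GaloisImage.WildFiveThreeTorsionValuation
import HarnessLib

/-!
# The SINGLE-SLOPE regime `v₃(j − 1728) ≥ 5` of the wild normal shape at `3`: the `9`-torsion
# abscissae and their separation ACROSS `3`-torsion classes
# (cell `b2b-bsdres`, team n1011, seat p02 gen 3, OWNERS row T-b10 'wild tower at 3' ARM A, file F3b)

HONEST FRAMING (cell `b2b-bsdres`, run/shared/lean/b2b/bsd-rank1-residual/, verbatim in every
file): the goal of the cell is to DELETE the COMBINATION-SHAPED residual classes of the
Birch–Swinnerton-Dyer formula for ALL analytic-rank `≤ 1` elliptic curves over `ℚ` — "full BSD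
formula for every rank `≤ 1` curve in class `C`" assembled STRICTLY from published theorems — so
that the rank-`≤ 1` remainder becomes exactly the CONSTRUCTION-SHAPED classes, which are TYPED
(missing-input `Prop`s), NOT attempted. This is not "finishing BSD". Team n1011 (N10 / N11, the
additive block X4 ∧ `p = 3`): research route on the CONSTRUCTION-SHAPED class X4; no claim beyond the
stated classes; nothing is booked. Theorems only (no definition, no named fact).

## What this file proves (`v` = the place over `3`, `t = v(3)`; normal shape `a₁ = a₃ = a₆ = 0`,
`a₄ = 1`, `v(a₂)⁶ ≤ t⁵`; `ξ, ξ₁, ξ₂` roots of `ψ₃`, all with `v(ξ)⁴t = 1` by F3a)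

* `valuation_pow_36_eq_of_mul_rel_wild5` — `ξ·ψ₃(x)² = Φ₃(x)` gives **`v(x)³⁶·t = 1`** (valuation
  `−1/36`): ONE Newton slope, `v(c₀) = v(ξ)`, margins `9c < 36a + 30b + k` for a monomial
  `3ᵃ·a₂ᵇ·ξᶜ` of `c_{9−k}`, root pinned by p14's `valuation_eq_of_monic_relation_nine` (TREE);
* `valuation_eval_Ψ₃_eq_one_wild5` — then `v(ψ₃(x)) = 1` (`−1` dominates);
* `valuation_sub_pow_36_of_cross_wild5` — **cross-class root separation**: if `x` lies over `ξ₁`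
  and `r` is a root of `G = Φ₃ − ξ₂ψ₃²` with `ξ₂ ∈ ψ₃.roots.erase ξ₁`, then `v(x − r)³⁶·t = 1`:
  `G(x) = (ξ₁ − ξ₂)ψ₃(x)²` has valuation `v(ξ₁ − ξ₂) = v(x)⁹` (F3a's separation at level `3`), and
  `G(x) = ∏(x − r')` over the nine roots of the monic `G`, each factor `≤ v(x)`.

So `x − r ∈ ℚ(E[9])` (a difference of `9`-torsion abscissae) has `3`-adic valuation with denominator
`36`: `9 ∣ #ρ̄_{E,9}(I)`.  Together with F3a's `8 ∣ #ρ̄_{E,3}(I)` this feeds p02 gen-2's criterion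
`9 ∣ e₉ ∧ 3 ∤ e₃` (file F3c).  Numerics (EVIDENCE, `HOME/b2b-bsdres-n1011-p02/wild/fprime_vals.py`): on
the `m = 5` cells all 36 values `ψ₉'(x_Q)/ψ₃` have one valuation, as the separation predicts.

References: J.-P. Serre, Invent. Math. 15 (1972) §1; Silverman *AEC* Ex. 3.7 (d); N. Katz (1973) §3.10.
-/

noncomputable section

-- numerals `x ^ 36` on the value group: see `WildShapeValuation`
set_option maxRecDepth 10000

open scoped Classical

open Polynomial WeierstrassCurve

namespace Summit.BirchSwinnertonDyer.Rank1Residual.GaloisImage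

open Literature.NumberTheory.EllipticCurves

variable {W : WeierstrassCurve (AlgebraicClosure ℚ)}

/-- **`v(x)³⁶·t = 1` for the abscissa above a `3`-torsion point in the single-slope regime**
(`ξψ₃(x)² = Φ₃(x)`, `v(ξ)⁴t = 1`, `v(a₂)⁶ ≤ t⁵`): the Newton polygon of `Φ₃ − ξψ₃²` is one segment.
[folklore] -/
theorem valuation_pow_36_eq_of_mul_rel_wild5 (h1 : W.a₁ = 0) (h3 : W.a₃ = 0) (h4 : W.a₄ = 1)
    (h6 : W.a₆ = 0)
    (hA : (placeOver 3).valuation W.a₂ ^ 6 ≤ (placeOver 3).valuation (3 : AlgebraicClosure ℚ) ^ 5)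
    {x ξ : AlgebraicClosure ℚ} (hrel : ξ * (W.Ψ₃.eval x) ^ 2 = (W.Φ 3).eval x)
    (hξ : (placeOver 3).valuation ξ ^ 4 * (placeOver 3).valuation (3 : AlgebraicClosure ℚ) = 1) :
    (placeOver 3).valuation x ^ 36 * (placeOver 3).valuation (3 : AlgebraicClosure ℚ) = 1 := by
  set v := (placeOver 3).valuation with hv
  set t := v (3 : AlgebraicClosure ℚ) with ht
  have ht1 : t < 1 := valuation_three_lt_one
  have ht0 : t ≠ 0 := valuation_three_ne_zero
  set α := v W.a₂ with hαdef
  set s := v ξ with hs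
  have hs0 : s ≠ 0 := by
    rintro h0; rw [h0, zero_pow (by norm_num), zero_mul] at hξ; exact zero_ne_one hξ
  obtain ⟨lam, hlam⟩ := IsAlgClosed.exists_pow_nat_eq ξ (by norm_num : 0 < 9)
  set β := v lam with hβ
  have hβ9 : β ^ 9 = s := by rw [hβ, ← map_pow, hlam]
  have hβ0 : β ≠ 0 := by
    intro h0; rw [h0, zero_pow (by norm_num)] at hβ9; exact hs0 hβ9.symm
  have hβ36 : β ^ 36 * t = 1 := by rw [show (36 : ℕ) = 9 * 4 by norm_num, pow_mul, hβ9, hξ]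
  -- margin lemma: `v(X) ≤ t^a α^b s^c` with `9c < 36a + 30b + k` gives `v(X) < β^k`
  have bnd : ∀ {X : AlgebraicClosure ℚ} {a b c k : ℕ}, v X ≤ t ^ a * α ^ b * s ^ c →
      9 * c < 36 * a + 30 * b + k → v X < β ^ k := by
    intro X a b c k hX hlt
    refine lt_of_pow_lt_pow_left₀ 36 zero_le ?_
    set T := t ^ (9 * c + k) with hT
    have hR : (β ^ k) ^ 36 * T = t ^ (9 * c) := by
      have e1 : (β ^ k) ^ 36 = s ^ (4 * k) := by
        rw [← pow_mul, show k * 36 = 9 * (4 * k) by ring, pow_mul, hβ9]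
      have e2 : s ^ (4 * k) * t ^ k = 1 := by rw [pow_mul s 4 k, ← mul_pow, hξ, one_pow]
      rw [e1, hT, pow_add, mul_comm (t ^ (9 * c)), ← mul_assoc, e2, one_mul]
    have hL : (t ^ a * α ^ b * s ^ c) ^ 36 * T ≤ t ^ (36 * a + 30 * b + k) := by
      have e1 : (α ^ b) ^ 36 ≤ t ^ (30 * b) := by
        rw [← pow_mul, show b * 36 = 6 * (6 * b) by ring, pow_mul α 6 (6 * b),
          show 30 * b = 5 * (6 * b) by ring, pow_mul t 5 (6 * b)]
        exact pow_le_pow_left₀ zero_le hA _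
      have e2 : (s ^ c) ^ 36 * t ^ (9 * c) = 1 := by
        rw [← pow_mul, show c * 36 = 4 * (9 * c) by ring, pow_mul s 4 (9 * c), ← mul_pow, hξ, one_pow]
      rw [mul_pow, mul_pow, hT, pow_add, ← pow_mul]
      calc t ^ (a * 36) * (α ^ b) ^ 36 * (s ^ c) ^ 36 * (t ^ (9 * c) * t ^ k)
          = t ^ (a * 36) * (α ^ b) ^ 36 * t ^ k * ((s ^ c) ^ 36 * t ^ (9 * c)) := by
            simp only [mul_assoc, mul_comm, mul_left_comm]
        _ ≤ t ^ (a * 36) * t ^ (30 * b) * t ^ k * 1 := by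
            rw [e2]; exact mul_le_mul' (mul_le_mul' (mul_le_mul' le_rfl e1) le_rfl) le_rfl
        _ = t ^ (36 * a + 30 * b + k) := by
            rw [mul_one, ← pow_add, ← pow_add]; congr 1; ring
    have key : v X ^ 36 * T < (β ^ k) ^ 36 * T := by
      calc v X ^ 36 * T ≤ (t ^ a * α ^ b * s ^ c) ^ 36 * T :=
            mul_le_mul' (pow_le_pow_left₀ zero_le hX 36) le_rfl
        _ ≤ t ^ (36 * a + 30 * b + k) := hL
        _ < t ^ (9 * c) := (pow_lt_pow_iff_of_lt_one' ht0 ht1).mpr hlt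
        _ = (β ^ k) ^ 36 * T := hR.symm
    exact lt_of_mul_lt_mul_right' key
  -- atoms and monomial calculus (as in `WildNineTorsionValuation`)
  have hle1 : ∀ n : ℕ, v (n : AlgebraicClosure ℚ) ≤ 1 := fun n ↦
    ((placeOver 3).valuation_le_one_iff _).mpr (natCast_mem (placeOver 3) n)
  have hN1 : ∀ n : ℕ, v ((3 * n : ℕ) : AlgebraicClosure ℚ) ≤ t ^ 1 * α ^ 0 * s ^ 0 := fun n ↦ by
    rw [Nat.cast_mul, map_mul, pow_one, pow_zero, pow_zero, mul_one, mul_one, Nat.cast_ofNat]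
    calc v 3 * v (n : AlgebraicClosure ℚ) ≤ t * 1 := mul_le_mul' le_rfl (hle1 n)
      _ = t := mul_one _
  have hN2 : ∀ n : ℕ, v ((9 * n : ℕ) : AlgebraicClosure ℚ) ≤ t ^ 2 * α ^ 0 * s ^ 0 := fun n ↦ by
    rw [Nat.cast_mul, map_mul, pow_zero, pow_zero, mul_one, mul_one,
      show ((9 : ℕ) : AlgebraicClosure ℚ) = 3 ^ 2 by norm_num, map_pow]
    calc t ^ 2 * v (n : AlgebraicClosure ℚ) ≤ t ^ 2 * 1 := mul_le_mul' le_rfl (hle1 n)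
      _ = t ^ 2 := mul_one _
  have hN0 : ∀ n : ℕ, v (n : AlgebraicClosure ℚ) ≤ t ^ 0 * α ^ 0 * s ^ 0 := fun n ↦ by
    simpa using hle1 n
  have h9 : v (9 : AlgebraicClosure ℚ) ≤ t ^ 2 * α ^ 0 * s ^ 0 := by simpa using hN2 1
  have h36 : v (36 : AlgebraicClosure ℚ) ≤ t ^ 2 * α ^ 0 * s ^ 0 := by simpa using hN2 4
  have h12 : v (12 : AlgebraicClosure ℚ) ≤ t ^ 1 * α ^ 0 * s ^ 0 := by simpa using hN1 4
  have h24 : v (24 : AlgebraicClosure ℚ) ≤ t ^ 1 * α ^ 0 * s ^ 0 := by simpa using hN1 8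
  have h30 : v (30 : AlgebraicClosure ℚ) ≤ t ^ 1 * α ^ 0 * s ^ 0 := by simpa using hN1 10
  have h48 : v (48 : AlgebraicClosure ℚ) ≤ t ^ 1 * α ^ 0 * s ^ 0 := by simpa using hN1 16
  have h8 : v (8 : AlgebraicClosure ℚ) ≤ t ^ 0 * α ^ 0 * s ^ 0 := by simpa using hN0 8
  have h16 : v (16 : AlgebraicClosure ℚ) ≤ t ^ 0 * α ^ 0 * s ^ 0 := by simpa using hN0 16
  have ha : v W.a₂ ≤ t ^ 0 * α ^ 1 * s ^ 0 := by simp [hαdef]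
  have hx' : v ξ ≤ t ^ 0 * α ^ 0 * s ^ 1 := by simp [hs]
  have hmul : ∀ {X Y : AlgebraicClosure ℚ} {a b c a' b' c' : ℕ}, v X ≤ t ^ a * α ^ b * s ^ c →
      v Y ≤ t ^ a' * α ^ b' * s ^ c' →
      v (X * Y) ≤ t ^ (a + a') * α ^ (b + b') * s ^ (c + c') := by
    intro X Y a b c a' b' c' hX hY
    rw [map_mul]
    calc v X * v Y ≤ (t ^ a * α ^ b * s ^ c) * (t ^ a' * α ^ b' * s ^ c') := mul_le_mul' hX hY
      _ = t ^ (a + a') * α ^ (b + b') * s ^ (c + c') := by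
          rw [pow_add, pow_add, pow_add]; simp only [mul_assoc, mul_comm, mul_left_comm]
  have hng : ∀ {X : AlgebraicClosure ℚ} {a b c : ℕ}, v X ≤ t ^ a * α ^ b * s ^ c →
      v (-X) ≤ t ^ a * α ^ b * s ^ c := by
    intro X a b c hX; rwa [Valuation.map_neg]
  have hsq : ∀ {X : AlgebraicClosure ℚ} {a b c : ℕ}, v X ≤ t ^ a * α ^ b * s ^ c →
      v (X ^ 2) ≤ t ^ (a + a) * α ^ (b + b) * s ^ (c + c) := by
    intro X a b c hX; rw [pow_two]; exact hmul hX hX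
  -- coefficient bounds, margins `9c < 36a + 30b + k`
  have hc8 : v (-9 * ξ) < β ^ 1 := bnd (hmul (hng h9) hx') (by omega)
  have hc7 : v (-12 - 24 * W.a₂ * ξ) < β ^ 2 :=
    Valuation.map_sub_lt _ (bnd (hng h12) (by omega)) (bnd (hmul (hmul h24 ha) hx') (by omega))
  have hc6 : v (-36 * ξ - 8 * W.a₂ - 16 * W.a₂ ^ 2 * ξ) < β ^ 3 :=
    Valuation.map_sub_lt _ (Valuation.map_sub_lt _ (bnd (hmul (hng h36) hx') (by omega))
      (bnd (hmul h8 ha) (by omega))) (bnd (hmul (hmul h16 (hsq ha)) hx') (by omega))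
  have hc5 : v (30 - 48 * W.a₂ * ξ) < β ^ 4 :=
    Valuation.map_sub_lt _ (bnd h30 (by omega)) (bnd (hmul (hmul h48 ha) hx') (by omega))
  have hc4 : v (-30 * ξ + 48 * W.a₂) < β ^ 5 :=
    Valuation.map_add_lt _ (bnd (hmul (hng h30) hx') (by omega)) (bnd (hmul h48 ha) (by omega))
  have hc3 : v (36 + 8 * W.a₂ * ξ + 16 * W.a₂ ^ 2) < β ^ 6 :=
    Valuation.map_add_lt _ (Valuation.map_add_lt _ (bnd h36 (by omega))
      (bnd (hmul (hmul h8 ha) hx') (by omega))) (bnd (hmul h16 (hsq ha)) (by omega))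
  have hc2 : v (12 * ξ + 24 * W.a₂) < β ^ 7 :=
    Valuation.map_add_lt _ (bnd (hmul h12 hx') (by omega)) (bnd (hmul h24 ha) (by omega))
  have hc1 : v (9 : AlgebraicClosure ℚ) < β ^ 8 := bnd h9 (by omega)
  have hc0 : v (-ξ) = β ^ 9 := by rw [Valuation.map_neg, hβ9]
  have hzero : x ^ 9 + ((-9 * ξ) * x ^ 8 + (-12 - 24 * W.a₂ * ξ) * x ^ 7 +
      (-36 * ξ - 8 * W.a₂ - 16 * W.a₂ ^ 2 * ξ) * x ^ 6 + (30 - 48 * W.a₂ * ξ) * x ^ 5 +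
      (-30 * ξ + 48 * W.a₂) * x ^ 4 + (36 + 8 * W.a₂ * ξ + 16 * W.a₂ ^ 2) * x ^ 3 +
      (12 * ξ + 24 * W.a₂) * x ^ 2 + 9 * x + -ξ) = 0 := by
    rw [← eval_Φ_three_sub_mul_Ψ₃_sq_of_shape h1 h3 h4 h6, ← hrel]; ring
  have hres := valuation_eq_of_monic_relation_nine v hβ0 hc0 hc1 hc2 hc3 hc4 hc5 hc6 hc7 hc8 hzero
  rw [hres, hβ36]

/-- **`v(ψ₃(x)) = 1`** for such an abscissa (`v(x)³⁶t = 1`, `v(a₂)⁶ ≤ t⁵`): in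
`ψ₃(x) = 3x⁴ + 4a₂x³ + 6x² − 1` the constant `−1` dominates. [folklore] -/
theorem valuation_eval_Ψ₃_eq_one_wild5 (h1 : W.a₁ = 0) (h3 : W.a₃ = 0) (h4 : W.a₄ = 1) (h6 : W.a₆ = 0)
    (hA : (placeOver 3).valuation W.a₂ ^ 6 ≤ (placeOver 3).valuation (3 : AlgebraicClosure ℚ) ^ 5)
    {x : AlgebraicClosure ℚ}
    (hx : (placeOver 3).valuation x ^ 36 * (placeOver 3).valuation (3 : AlgebraicClosure ℚ) = 1) :
    (placeOver 3).valuation (W.Ψ₃.eval x) = 1 := by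
  set v := (placeOver 3).valuation with hv
  set t := v (3 : AlgebraicClosure ℚ) with ht
  have ht1 : t < 1 := valuation_three_lt_one
  have ht0 : t ≠ 0 := valuation_three_ne_zero
  set α := v W.a₂ with hαdef
  set β := v x with hβ
  have h4' : v (4 : AlgebraicClosure ℚ) = 1 := by
    simpa using valuation_intCast_eq_one_of_not_dvd (n := 4) (by decide)
  have h6' : v (6 : AlgebraicClosure ℚ) = t := by
    rw [show (6 : AlgebraicClosure ℚ) = 2 * 3 by norm_num, map_mul,
      show v (2 : AlgebraicClosure ℚ) = 1 by
        simpa using valuation_intCast_eq_one_of_not_dvd (n := 2) (by decide), one_mul]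
  -- `t β⁴ < 1`, `α β³ < 1`, `t β² < 1`
  have hi : v (3 * x ^ 4) < 1 := by
    rw [map_mul, map_pow]
    refine lt_of_pow_lt_pow_left₀ 9 zero_le ?_
    rw [one_pow, mul_pow, ← pow_mul, show 4 * 9 = 36 by norm_num,
      show t ^ 9 = t ^ 8 * t by rw [← pow_succ], mul_assoc, mul_comm t, hx, mul_one]
    exact pow_lt_one₀ zero_le ht1 (by norm_num)
  have hii : v (4 * W.a₂ * x ^ 3) < 1 := by
    rw [map_mul, map_mul, h4', one_mul, map_pow]
    refine lt_of_pow_lt_pow_left₀ 12 zero_le ?_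
    rw [one_pow, mul_pow, ← pow_mul, show 3 * 12 = 36 by norm_num]
    have e : α ^ 12 * β ^ 36 * t = α ^ 12 := by rw [mul_assoc, hx, mul_one]
    have hα12 : α ^ 12 ≤ t ^ 10 := by
      calc α ^ 12 = (α ^ 6) ^ 2 := by rw [← pow_mul]
        _ ≤ (t ^ 5) ^ 2 := pow_le_pow_left₀ zero_le hA 2
        _ = t ^ 10 := by rw [← pow_mul]
    have key : α ^ 12 * β ^ 36 * t < 1 * t := by
      rw [e, one_mul]
      calc α ^ 12 ≤ t ^ 10 := hα12
        _ < t ^ 1 := (pow_lt_pow_iff_of_lt_one' ht0 ht1).mpr (by norm_num)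
        _ = t := pow_one t
    exact lt_of_mul_lt_mul_right' key
  have hiii : v (6 * x ^ 2) < 1 := by
    rw [map_mul, h6', map_pow]
    refine lt_of_pow_lt_pow_left₀ 18 zero_le ?_
    rw [one_pow, mul_pow, ← pow_mul, show 2 * 18 = 36 by norm_num,
      show t ^ 18 = t ^ 17 * t by rw [← pow_succ], mul_assoc, mul_comm t, hx, mul_one]
    exact pow_lt_one₀ zero_le ht1 (by norm_num)
  rw [eval_Ψ₃_of_shape h1 h3 h4 h6, sub_eq_add_neg, add_comm]
  have h : v (3 * x ^ 4 + 4 * W.a₂ * x ^ 3 + 6 * x ^ 2) < v (-1 : AlgebraicClosure ℚ) := by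
    rw [Valuation.map_neg, map_one]
    exact Valuation.map_add_lt _ (Valuation.map_add_lt _ hi hii) hiii
  rw [Valuation.map_add_eq_of_lt_left _ h, Valuation.map_neg, map_one]

/-- Uniqueness of the solution of `y⁴·t = 1` resp. `y³⁶·t = 1` in the value group. [folklore] -/
theorem eq_of_pow_mul_eq_one {Γ₀ : Type*} [LinearOrderedCommGroupWithZero Γ₀] {y y' t : Γ₀} {n : ℕ}
    (hn : n ≠ 0) (ht : t ≠ 0) (h : y ^ n * t = 1) (h' : y' ^ n * t = 1) : y = y' :=
  pow_left_injective_of_ne_zero hn (mul_right_cancel₀ ht (h.trans h'.symm))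

/-- **Cross-class root separation at level `9`** (single-slope regime): let `x` satisfy
`ξ₁ψ₃(x)² = Φ₃(x)` (the abscissa of a point `Q` with `3Q = ±(ξ₁, ·)`), let `ξ₂ ∈ ψ₃.roots.erase ξ₁` be
ANOTHER `3`-torsion abscissa and `r` a root of `G = Φ₃ − ξ₂ψ₃²` (the abscissa of a point `Q'` with
`3Q' = ±(ξ₂, ·)`).  Then `v(x − r)³⁶·t = 1`: `G` is monic of degree `9` with all roots of valuation
`v(x)`, `G(x) = (ξ₁ − ξ₂)ψ₃(x)²` has valuation `v(ξ₁ − ξ₂) = v(x)⁹`, and a product of nine factors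
`≤ v(x)` equal to `v(x)⁹` has all factors equal to `v(x)`. [folklore] -/
theorem valuation_sub_pow_36_of_cross_wild5 (h1 : W.a₁ = 0) (h3 : W.a₃ = 0) (h4 : W.a₄ = 1)
    (h6 : W.a₆ = 0)
    (hA : (placeOver 3).valuation W.a₂ ^ 6 ≤ (placeOver 3).valuation (3 : AlgebraicClosure ℚ) ^ 5)
    {x ξ₁ ξ₂ r : AlgebraicClosure ℚ} (hrel : ξ₁ * (W.Ψ₃.eval x) ^ 2 = (W.Φ 3).eval x)
    (hξ₁ : ξ₁ ∈ W.Ψ₃.roots) (hξ₂ : ξ₂ ∈ W.Ψ₃.roots.erase ξ₁)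
    (hr : (W.Φ 3 - C ξ₂ * W.Ψ₃ ^ 2).IsRoot r) :
    (placeOver 3).valuation (x - r) ^ 36 * (placeOver 3).valuation (3 : AlgebraicClosure ℚ) = 1 := by
  set v := (placeOver 3).valuation with hv
  set t := v (3 : AlgebraicClosure ℚ) with ht
  have ht0 : t ≠ 0 := valuation_three_ne_zero
  have hW3 : (3 : AlgebraicClosure ℚ) ≠ 0 := by norm_num
  have hΨ0 : W.Ψ₃ ≠ 0 := by
    intro h0; have := W.natDegree_Ψ₃ hW3; rw [h0, natDegree_zero] at this
    exact absurd this (by norm_num)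
  -- the `3`-torsion abscissae
  have hξ₁4 := valuation_pow_four_of_isRoot_Ψ₃_wild5 h1 h3 h4 h6 hA ((mem_roots hΨ0).mp hξ₁)
  have hξ₂4 := valuation_pow_four_of_isRoot_Ψ₃_wild5 h1 h3 h4 h6 hA
    ((mem_roots hΨ0).mp (Multiset.mem_of_mem_erase hξ₂))
  have hsep := valuation_sub_pow_four_of_mem_roots_Ψ₃_wild5 h1 h3 h4 h6 hA hξ₁ hξ₂
  -- `β = v(x)`, `β³⁶ t = 1`
  have hx := valuation_pow_36_eq_of_mul_rel_wild5 h1 h3 h4 h6 hA hrel hξ₁4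
  set β := v x with hβ
  have hβ0 : β ≠ 0 := by
    rintro h0; rw [h0, zero_pow (by norm_num), zero_mul] at hx; exact zero_ne_one hx
  have hβ9 : (β ^ 9) ^ 4 * t = 1 := by rw [← pow_mul]; exact hx
  have hsepβ : v (ξ₁ - ξ₂) = β ^ 9 := eq_of_pow_mul_eq_one (by norm_num) ht0 hsep hβ9
  -- the polynomial `G = Φ₃ − ξ₂ψ₃²`: monic of degree `9`, splits
  set G := W.Φ 3 - C ξ₂ * W.Ψ₃ ^ 2 with hG
  have hΦm : (W.Φ 3).Monic := W.leadingCoeff_Φ 3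
  have hΦd : (W.Φ 3).natDegree = 9 := by rw [W.natDegree_Φ]; norm_num
  have hlow : (C ξ₂ * W.Ψ₃ ^ 2).degree < (W.Φ 3).degree := by
    rw [degree_eq_natDegree hΦm.ne_zero, hΦd]
    refine (degree_mul_le _ _).trans_lt ?_
    refine (add_le_add degree_C_le (degree_pow_le _ _)).trans_lt ?_
    rw [zero_add]
    calc 2 • W.Ψ₃.degree ≤ 2 • (4 : WithBot ℕ) :=
          nsmul_le_nsmul_right (degree_le_of_natDegree_le W.natDegree_Ψ₃_le) 2
      _ < 9 := by decide
  have hGm : G.Monic := hΦm.sub_of_left hlow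
  have hGd : G.natDegree = 9 := by
    have hlow' : (C ξ₂ * W.Ψ₃ ^ 2).natDegree < (W.Φ 3).natDegree := by
      rw [hΦd]
      calc (C ξ₂ * W.Ψ₃ ^ 2).natDegree ≤ (C ξ₂).natDegree + (W.Ψ₃ ^ 2).natDegree := natDegree_mul_le
        _ ≤ 0 + 2 * 4 := by
            refine add_le_add (natDegree_C _).le ((natDegree_pow_le).trans ?_)
            exact Nat.mul_le_mul_left 2 W.natDegree_Ψ₃_le
        _ < 9 := by norm_num
    rw [hG, natDegree_sub_eq_left_of_natDegree_lt hlow', hΦd]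
  have hG0 : G ≠ 0 := hGm.ne_zero
  have hGsplit := IsAlgClosed.splits G
  have hGprod : G = (G.roots.map (X - C ·)).prod := hGsplit.eq_prod_roots_of_monic hGm
  have hGcard : Multiset.card G.roots = 9 := by rw [← hGd]; exact splits_iff_card_roots.mp hGsplit
  -- every root of `G` has valuation `β`
  have hrootβ : ∀ r' ∈ G.roots, v r' = β := by
    intro r' hr'
    have hrel' : ξ₂ * (W.Ψ₃.eval r') ^ 2 = (W.Φ 3).eval r' := by
      have := ((mem_roots hG0).mp hr').eq_zero
      rw [hG, eval_sub, eval_mul, eval_C, eval_pow] at this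
      linear_combination -this
    exact eq_of_pow_mul_eq_one (by norm_num) ht0
      (valuation_pow_36_eq_of_mul_rel_wild5 h1 h3 h4 h6 hA hrel' hξ₂4) hx
  -- `G(x) = (ξ₁ − ξ₂) ψ₃(x)² = ∏ (x − r')`
  have hGx : G.eval x = (ξ₁ - ξ₂) * (W.Ψ₃.eval x) ^ 2 := by
    rw [hG, eval_sub, eval_mul, eval_C, eval_pow, ← hrel]; ring
  have hGx' : G.eval x = (G.roots.map (fun a ↦ x - a)).prod := by
    conv_lhs => rw [hGprod]
    rw [eval_multiset_prod, Multiset.map_map]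
    exact congrArg Multiset.prod (Multiset.map_congr rfl fun a _ ↦ by simp)
  have hΨx : v (W.Ψ₃.eval x) = 1 := valuation_eval_Ψ₃_eq_one_wild5 h1 h3 h4 h6 hA hx
  have hprodv : (G.roots.map (fun a ↦ v (x - a))).prod = β ^ Multiset.card G.roots := by
    have := congrArg v hGx'
    rw [hGx, map_mul, map_pow, hΨx, one_pow, mul_one, hsepβ, map_multiset_prod, Multiset.map_map] at this
    rw [hGcard]; exact this.symm
  have hle : ∀ a ∈ G.roots, v (x - a) ≤ β := fun a ha ↦
    Valuation.map_sub_le _ le_rfl (by rw [hrootβ a ha])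
  have hall := eq_of_prod_map_eq_pow_card (f := fun a ↦ v (x - a)) hβ0 hle hprodv
  have hxr : v (x - r) = β := hall r ((mem_roots hG0).mpr hr)
  rw [hxr, hx]

end Summit.BirchSwinnertonDyer.Rank1Residual.GaloisImage

end
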